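import Literature.NumberTheory.Automorphic.UnitaryGroupRankOneBigCell      -- ★ `exists_coe_eq_diag` (torus elements `d(α, β, (σα)⁻¹)`)
import Literature.NumberTheory.Automorphic.UnitaryGroupBorelPair            -- ★ `glDiagonal_mem_unitaryGroupOfForm_antidiagonal_iff`
import HarnessLib

/-!
# The diagonal torus of `U(σ, Φ₃)(K)` is generated by the CENTRE and the CONTRACTING RAYS `d(α, 1, (σα)⁻¹)`, `0 < |α| < 1`
# (Rogawski 1990, §1.10: `M = {d(α, β, ᾱ⁻¹)}`; every `d(α, β, ᾱ⁻¹) = (β·1) · d(α₁, 1, ᾱ₁⁻¹) · d(α₂, 1, ᾱ₂⁻¹)⁻¹` with `|α₁|, |α₂| < 1`)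

Topic `NumberTheory/Automorphic`; namespace `Literature.NumberTheory.Automorphic.UnitaryGroup`.  THEOREMS ONLY (no definition, no named fact, no instance,
no notation, no `sorry`).  Cell `hodgecm-mathlib`, F0∕P3c line LH6, organ (S-i) `stub_StNoncuspidalMember` of `Cruxes/H413/Lines/F0_P3c_StCharTSPaydown.lean` :297,
seat LH6-p02 (g0), brick «TORUS-GEN» (model half): the shell identities of the (S-i) road (★ R2d `Representation.smoothTrace_indicator_shell_eq`) are available
exactly on the strictly dominant torus elements `z · d(α, 1, (σα)⁻¹)ᵐ` (`z` central, `0 < |α| < 1`, ★ `F0P3CMBorelIwahoriDatum.exists_cmIwahoriDatum`); to apply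
Artin's independence of characters on that subsemigroup (★ «ARTIN-B» `F0P3cStCharTSArtinMonoid`) one needs that it GENERATES the torus `T = {d(α, β, (σα)⁻¹)}`
[Rogawski1990, §1.10 p. 9].  This file proves the decomposition on the one-place model `U(σ, Φ₃)(K)` (`K` a valued field, `σ` an involution): every
`t = d(d₀, β, (σ d₀)⁻¹) ∈ T` is `(β·1) · d(α₁, 1, (σα₁)⁻¹) · d(α₂, 1, (σα₂)⁻¹)⁻¹` with `β·1` a unitary SCALAR (central), `α₁ = (d₀∕β)ϖᴺ`, `α₂ = ϖᴺ`, `|α₁|, |α₂| < 1`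
for `N ≫ 0` (`ϖ` any element with `0 < |ϖ| < 1`).  HONEST SCOPE: model-level matrix algebra; HC_CM is proved only modulo the printed citations until rung 0 closes.

## References
* [Rogawski1990] J. D. Rogawski, *Automorphic Representations of Unitary Groups in Three Variables*, Ann. of Math. Stud. 123 (1990), §1.10 p. 9.
* [PlatonovRapinchuk1994] V. Platonov, A. Rapinchuk, *Algebraic Groups and Number Theory* (1994), §2.3 (tori of unitary groups).
-/

set_option autoImplicit false

open scoped MatrixGroups WithZero
open Matrix

namespace Literature.NumberTheory.Automorphic

namespace UnitaryGroup

variable {K : Type*} [Field K] [Valued K ℤᵐ⁰] (σ : K →+* K) {J : Matrix (Fin 3) (Fin 3) K} (hJ : J = (StdForm.antidiagonal 3).over K)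

omit [Valued K ℤᵐ⁰] in
include hJ in
/-- **The shape of a torus element**: `t ∈ T` has matrix `d(d₀, β, (σ d₀)⁻¹)` with `d₀ ≠ 0` and `σ β · β = 1`. [cite: Rogawski1990, §1.10 p. 9] -/
theorem exists_coe_eq_diag_of_mem_torusU {t : ↥(unitaryGroupOfForm σ J)} (ht : t ∈ torusU σ J) :
    ∃ d₀ β : K, d₀ ≠ 0 ∧ σ β * β = 1 ∧ ((t : GL (Fin 3) K) : Matrix (Fin 3) (Fin 3) K) = !![d₀, 0, 0; 0, β, 0; 0, 0, (σ d₀)⁻¹] := by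
  obtain ⟨d, hd⟩ := (mem_torusU_iff t).1 ht
  have hmem : glDiagonal 3 K d ∈ unitaryGroupOfForm σ ((StdForm.antidiagonal 3).over K) := by rw [← hJ, hd]; exact t.2
  rw [glDiagonal_mem_unitaryGroupOfForm_antidiagonal_iff] at hmem
  have h1 : σ (d 1 : K) * (d 1 : K) = 1 := by simpa using hmem 1
  have h2 : σ (d 0 : K) * (d 2 : K) = 1 := by simpa using hmem 2
  have hd2 : (d 2 : K) = (σ (d 0 : K))⁻¹ := eq_inv_of_mul_eq_one_right h2
  refine ⟨d 0, d 1, (d 0).ne_zero, h1, ?_⟩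
  rw [← hd, coe_glDiagonal]
  ext i j
  fin_cases i <;> fin_cases j <;> simp [Matrix.diagonal, hd2]

include hJ in
/-- **«TORUS-GEN» (model): the torus is generated by the centre and the contracting rays.**  For `ϖ` with `0 < |ϖ| < 1`, every `t ∈ T ≤ U(σ, Φ₃)(K)` factors as
`t = z · r₁ · r₂⁻¹` with `z ∈ T` a unitary SCALAR matrix (hence central), and `r₁, r₂ ∈ U` with matrices `d(αᵢ, 1, (σαᵢ)⁻¹)`, `αᵢ ≠ 0`, `|αᵢ| < 1`.
[cite: Rogawski1990, §1.10 p. 9] [cite: PlatonovRapinchuk1994, §2.3] -/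
theorem exists_scalar_mul_ray_mul_ray_inv (hσσ : ∀ x, σ (σ x) = x) {ϖ : K} (hϖ0 : ϖ ≠ 0) (hϖ1 : Valued.v ϖ < 1)
    {t : ↥(unitaryGroupOfForm σ J)} (ht : t ∈ torusU σ J) :
    ∃ (z r₁ r₂ : ↥(unitaryGroupOfForm σ J)) (β α₁ α₂ : K),
      z ∈ torusU σ J ∧ ((z : GL (Fin 3) K) : Matrix (Fin 3) (Fin 3) K) = !![β, 0, 0; 0, β, 0; 0, 0, β] ∧
      α₁ ≠ 0 ∧ Valued.v α₁ < 1 ∧ ((r₁ : GL (Fin 3) K) : Matrix (Fin 3) (Fin 3) K) = Matrix.diagonal ![α₁, 1, (σ α₁)⁻¹] ∧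
      α₂ ≠ 0 ∧ Valued.v α₂ < 1 ∧ ((r₂ : GL (Fin 3) K) : Matrix (Fin 3) (Fin 3) K) = Matrix.diagonal ![α₂, 1, (σ α₂)⁻¹] ∧
      t = z * r₁ * r₂⁻¹ := by
  obtain ⟨d₀, β, hd₀, hβ, htm⟩ := exists_coe_eq_diag_of_mem_torusU σ hJ ht
  have hβ0 : β ≠ 0 := fun h => by rw [h, mul_zero] at hβ; exact zero_ne_one hβ
  have hσβ : σ β = β⁻¹ := eq_inv_of_mul_eq_one_left hβ
  -- the exponent `N`: `|d₀/β| · |ϖ|^N < 1`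
  obtain ⟨N, hN⟩ : ∃ N : ℕ, Valued.v (d₀ / β * ϖ ^ N) < 1 := by
    have hx : Valued.v (d₀ / β) ≠ 0 := (Valuation.ne_zero_iff _).2 (div_ne_zero hd₀ hβ0)
    have hy : Valued.v ϖ ≠ 0 := (Valuation.ne_zero_iff _).2 hϖ0
    obtain ⟨a, ha⟩ : ∃ a : ℤ, Valued.v (d₀ / β) = WithZero.exp a := ⟨WithZero.log _, (WithZero.exp_log hx).symm⟩
    obtain ⟨k, hk⟩ : ∃ k : ℤ, Valued.v ϖ = WithZero.exp k := ⟨WithZero.log _, (WithZero.exp_log hy).symm⟩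
    have hk0 : k < 0 := by rw [hk, ← WithZero.exp_zero, WithZero.exp_lt_exp] at hϖ1; exact hϖ1
    refine ⟨a.toNat + 1, ?_⟩
    rw [map_mul, map_pow, ha, hk, ← WithZero.exp_nsmul, ← WithZero.exp_add, ← WithZero.exp_zero, WithZero.exp_lt_exp, nsmul_eq_mul]
    have h1 : a ≤ (a.toNat : ℤ) := Int.self_le_toNat a
    have h2 : ((a.toNat + 1 : ℕ) : ℤ) * k ≤ ((a.toNat + 1 : ℕ) : ℤ) * (-1) :=
      mul_le_mul_of_nonneg_left (by omega) (by positivity)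
    push_cast at h2 ⊢
    linarith
  -- the three factors
  have hα₁0 : d₀ / β * ϖ ^ N ≠ 0 := mul_ne_zero (div_ne_zero hd₀ hβ0) (pow_ne_zero N hϖ0)
  have hα₂0 : ϖ ^ N ≠ 0 := pow_ne_zero N hϖ0
  obtain ⟨z, hzT, hz⟩ := exists_coe_eq_diag σ hJ hσσ hβ0 hβ
  -- the rays: `α₁ := d₀/β · ϖ^N · ϖ`, `α₂ := ϖ^N · ϖ` (the extra factor `ϖ` makes `|α₂| < 1` also when `N = 0`)
  have hα₁0' : d₀ / β * ϖ ^ N * ϖ ≠ 0 := mul_ne_zero hα₁0 hϖ0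
  have hα₂0' : ϖ ^ N * ϖ ≠ 0 := mul_ne_zero hα₂0 hϖ0
  have hα₁1' : Valued.v (d₀ / β * ϖ ^ N * ϖ) < 1 := by
    rw [map_mul]; exact mul_lt_one_of_nonneg_of_lt_one_left zero_le hN (le_of_lt hϖ1)
  have hα₂1' : Valued.v (ϖ ^ N * ϖ) < 1 := by
    rw [map_mul, map_pow]
    exact mul_lt_one_of_nonneg_of_lt_one_right (pow_le_one₀ zero_le (le_of_lt hϖ1)) zero_le hϖ1
  obtain ⟨r₁, -, hr₁⟩ := exists_coe_eq_diag σ hJ hσσ hα₁0' (β := 1) (by rw [map_one, mul_one])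
  obtain ⟨r₂, -, hr₂⟩ := exists_coe_eq_diag σ hJ hσσ hα₂0' (β := 1) (by rw [map_one, mul_one])
  refine ⟨z, r₁, r₂, β, d₀ / β * ϖ ^ N * ϖ, ϖ ^ N * ϖ, hzT, ?_, hα₁0', hα₁1', ?_, hα₂0', hα₂1', ?_, ?_⟩
  · rw [hz, hσβ, inv_inv]
  · rw [hr₁]; ext i j; fin_cases i <;> fin_cases j <;> simp
  · rw [hr₂]; ext i j; fin_cases i <;> fin_cases j <;> simp
  · -- `t = z r₁ r₂⁻¹ ⟺ t r₂ = z r₁`, a diagonal-matrix identity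
    rw [eq_mul_inv_iff_mul_eq]
    apply Subtype.ext; apply Units.ext
    change ((t : GL (Fin 3) K) : Matrix (Fin 3) (Fin 3) K) * ((r₂ : GL (Fin 3) K) : Matrix (Fin 3) (Fin 3) K) =
      ((z : GL (Fin 3) K) : Matrix (Fin 3) (Fin 3) K) * ((r₁ : GL (Fin 3) K) : Matrix (Fin 3) (Fin 3) K)
    rw [htm, hr₂, hz, hr₁]
    have hσϖ : σ ϖ ≠ 0 := (map_ne_zero σ).2 hϖ0
    have hσd₀ : σ d₀ ≠ 0 := (map_ne_zero σ).2 hd₀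
    ext i j
    fin_cases i <;> fin_cases j <;> simp [Matrix.mul_apply, Fin.sum_univ_three, map_mul, map_pow, map_div₀, hσβ] <;> field_simp

end UnitaryGroup

end Literature.NumberTheory.Automorphic
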